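import Summits.QuantumFields.BalabanUV.InfraRed.StrongCouplingFluxCovariance
import HarnessLib

/-!
# Strong-coupling front, J-SC16l: NUMERIC INSTANCES of the hypothesis-free doors — Wilson `β_W = 0.222` and the
integer bare coupling `g² = 19` — observatory of the non-perturbative crossover; no mass-gap claim

IR-3 v2 TWO-FRONT CROSSOVER LEDGER, front SC (`β₀`), SU(2), `d = 4`, Wilson normalisation `β_W = 4/g²`.
ABSOLUTE RULE of this package: No internally-minted statement may enter as a cited fact. Every hypothesis is either
kernel-proved in this package or a verbatim quotation of a PUBLISHED theorem with page reference. The manuscript(s)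
under audit are NOT citable for their own disputed steps — they are the thing under adjudication; programme-internal
(2001/route/tribunal) claims are never citable.  Nothing is cited here: the statements below are specialisations of
kernel theorems of this package ([folklore] labels are attributions, not citations).

## What this file is

Leaf (23) of the strong-coupling front: ONE-LINE SPECIALISATIONS of leaf (22)'s hypothesis-free ∀-doors
(`StrongCouplingFluxCovariance.su2_strongCouplingFront`, `su2_dlrMassGapAt`, `su2_latticeMassGap`, valid at every
Wilson `0 ≤ β_W < 2/9`) at FILED numeric couplings, in the three ledger currencies by exact type and in the shape of
J-SC13's `…_01924` instances (`StrongCouplingSharpWindow`) — the crossover ledger carries FILED instances, not window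
suprema (request of the ledger's records seat):
* Wilson `β_W = 0.222 = 111/500` (`0.222 < 2/9 = 0.2222…`; bare coupling `g² = 4/β_W = 18.02`):
  SC-a `su2_dlrMassGapAt_0222 : DLRMassGapAt 4 2 (0.222/4)` (infinite-volume DLR uniqueness and clustering, 't Hooft
  coupling `β_W/4`), SC-b `su2_strongCouplingFront_0222 : StrongCouplingFront (fundamentalLatticeRep 2) (0.222/2)`
  (volume-uniform torus front, tree coupling `β_W/2`), SC-c `su2_latticeMassGap_0222 : LatticeMassGap
  (fundamentalRep (Fin 2)) (0.222/2) (krRate (18 · 0.222 · 1/4))` (rate explicit);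
* the integer bare coupling `g² = 19`, i.e. `β_W = 4/19 = 0.2105…` (`4/19 < 2/9 ⟺ 36 < 38`): the same three
  currencies (`…_four_div_nineteen`) — every INTEGER `g² ≥ 19` lies in the kernel-decided window; `g² = 18` is the
  excluded end-point `β_W = 2/9` (the ceiling of the single-site Dobrushin door, `StrongCouplingDobrushinFloor`).
Previously filed instances: `β_W = 0.1924`, `g² = 21` (J-SC13).

NOT CLAIMED: anything at `β_W ≥ 2/9`, at weak coupling, uniformly in `β`, or about a continuum limit; no mass-gap
claim in the sense of the summit.
-/


open MeasureTheory Filter Finset Real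
open scoped NNReal Quaternion Matrix ComplexConjugate BigOperators Matrix.Norms.Frobenius ContDiff Topology
  RealInnerProductSpace

open Matrix Complex
open Literature.MathematicalPhysics.QuantumLattice (su2Quat quatMatrix quatMatrix_mul quatMatrix_su2Quat norm_su2Quat)
open Literature.MathematicalPhysics.QuantumFieldTheory
open Literature.MathematicalPhysics.QuantumFieldTheory.SUNBakryEmery
open Literature.MathematicalPhysics.QuantumFieldTheory.Balaban1983to89.StrongCouplingVarianceWindow (qI qJ qK)
open Literature.MathematicalPhysics.QuantumLattice (fundamentalRep fundamentalLatticeRep)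
open Literature.MathematicalPhysics.QuantumFieldTheory.Balaban1983to89
open Literature.MathematicalPhysics.QuantumFieldTheory.Balaban1983to89.StrongCouplingVarianceWindow
open Literature.MathematicalPhysics.QuantumFieldTheory.Balaban1983to89.StrongCouplingKernelWindow
open Literature.MathematicalPhysics.QuantumFieldTheory.Balaban1983to89.StrongCouplingDobrushinWindow
open Literature.MathematicalPhysics.QuantumFieldTheory.Balaban1983to89.StrongCouplingTorusWindow
open Literature.MathematicalPhysics.QuantumFieldTheory.Balaban1983to89.StrongCouplingOpenWindow
open Literature.Probability.LatticeModels
open Summit.QuantumFields.BalabanUV.InfraRed.StrongCouplingSixFifthsVariance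
open Summit.QuantumFields.BalabanUV.InfraRed.StrongCouplingReflection

namespace Summit.QuantumFields.BalabanUV.InfraRed.StrongCouplingTwoNinthsInstances

open Summit.QuantumFields.BalabanUV.InfraRed.StrongCouplingFluxCovariance

/-! ## 1. Wilson `β_W = 0.222` -/

/-- **SC-a at `β_W = 0.222`** (infinite-volume DLR; 't Hooft `0.222/4`): `0 ≤ 0.222` and `0.222 < 2/9`. [folklore] -/
theorem su2_dlrMassGapAt_0222 : DLRMassGapAt 4 2 ((0.222 : ℝ) / 4) :=
  su2_dlrMassGapAt (by norm_num) (by norm_num)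

/-- **SC-b at `β₀W = 0.222`** (volume-uniform torus front at every tree coupling `≤ 0.222/2 = 0.111`;
`g² = 4/0.222 = 18.02`). [folklore] -/
theorem su2_strongCouplingFront_0222 :
    CrossoverLedger.StrongCouplingFront (fundamentalLatticeRep 2) ((0.222 : ℝ) / 2) :=
  su2_strongCouplingFront (by norm_num) (by norm_num)

/-- **SC-c at `β_W = 0.222`** (the ledger's `LatticeMassGap` currency, rate `krRate (18 · 0.222 · 1/4)`
= `krRate 0.999`). [folklore] -/
theorem su2_latticeMassGap_0222 :
    CrossoverLedger.LatticeMassGap (fundamentalRep (Fin 2)) ((0.222 : ℝ) / 2)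
      (krRate (18 * (0.222 : ℝ) * (1 / 4))) :=
  su2_latticeMassGap (by norm_num) (by norm_num)

/-! ## 2. The integer bare coupling `g² = 19` (`β_W = 4/19`) -/

/-- **SC-a at `β_W = 4/19`** (`g² = 19`; `4/19 = 0.2105 < 2/9`). Every integer `g² ≥ 19` lies in the window;
`g² = 18` is the excluded end-point `β_W = 2/9`. [folklore] -/
theorem su2_dlrMassGapAt_four_div_nineteen : DLRMassGapAt 4 2 ((4 / 19 : ℝ) / 4) :=
  su2_dlrMassGapAt (by norm_num) (by norm_num)

/-- **SC-b at `β₀W = 4/19`** (`g² = 19`). [folklore] -/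
theorem su2_strongCouplingFront_four_div_nineteen :
    CrossoverLedger.StrongCouplingFront (fundamentalLatticeRep 2) ((4 / 19 : ℝ) / 2) :=
  su2_strongCouplingFront (by norm_num) (by norm_num)

/-- **SC-c at `β_W = 4/19`** (`g² = 19`; rate `krRate (18 · (4/19) · 1/4) = krRate (18/19)`). [folklore] -/
theorem su2_latticeMassGap_four_div_nineteen :
    CrossoverLedger.LatticeMassGap (fundamentalRep (Fin 2)) ((4 / 19 : ℝ) / 2)
      (krRate (18 * (4 / 19 : ℝ) * (1 / 4))) :=
  su2_latticeMassGap (by norm_num) (by norm_num)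

end Summit.QuantumFields.BalabanUV.InfraRed.StrongCouplingTwoNinthsInstances
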